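import Literature.NumberTheory.DiophantineGeometry.SchurWeylPlethysmKroneckerBoundProofs
import Literature.Computability.AlgebraicComplexity.Hyperdeterminant
import HarnessLib

/-!
# The semigroup property of the Kronecker coefficients

For partitions `λ, μ, ν ⊢ a` and `λ', μ', ν' ⊢ b`:
`g(λ, μ, ν) > 0` and `g(λ', μ', ν') > 0` imply `g(λ + λ', μ + μ', ν + ν') > 0` (row-wise sums),
for the Kronecker coefficients `kroneckerCoeff k λ μ ν = dim Hom_{S_a}(S^λ ⊗ S^μ, S^ν)` of
`SymmetricGroupReps` over a field `k` of characteristic zero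
(`kroneckerCoeff_pos_of_ofPartition_add`, the sums being described by their weights
`Weight.ofPartition N`; the discharge of the named fact
`Literature.Computability.Complexity.ikenmeyerPanova2017_semigroup`, stated with
`Nat.Partition.rowAdd`, is in `Literature/Computability/Complexity/OccurrenceObstructionsIPSemigroup.lean`).
Source: the semigroup property is due to M. Christandl, A. W. Harrow, G. Mitchison, *Nonzero
Kronecker coefficients and what they tell us about spectra*, Comm. Math. Phys. 270 (2007)
575–585 (via highest-weight vectors / spectra of quantum states); we follow the statement and
one-line proof of C. Ikenmeyer, G. Panova, Adv. Math. 319 (2017), §1.1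
("The semigroup property … is easy to see if we interpret `g(λ, μ, ν)` as the dimension of the
`(λ, μ, ν)`-highest weight vector space in the coordinate ring of `V ⊗ V ⊗ V` … the semigroup
property follows from multiplying highest weight vectors"). This file formalises exactly that
argument, in the word model of the tree.

## Proof

Fix `N` at least the number of parts of all partitions involved, `W_a = Word N a = (Fin a → Fin N)`.

1. **`g(λ, μ, ν)` as a space of triple tensors** (§4): let
   `HW_λ = highestWeightSpace (wordRep k N a) λ ⊆ k^{W_a}` (the highest-weight vectors of weight
   `λ` of `(k^N)^{⊗a}`; an `S_a`-module with character `χ^λ`, `character_hwPermRep`,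
   Schur–Weyl duality of `WordHighestWeightSpecht`). The functions `M : (W_a × W_a) × W_a → k`
   all of whose partial functions lie in `HW_λ`, `HW_μ`, `HW_ν` form the slice space
   `HW_λ ⊗ HW_μ ⊗ HW_ν` (`SliceRepresentation`, nested twice), and by the invariant-dimension
   formula `a! · dim (HW_λ ⊗ HW_μ ⊗ HW_ν)^{S_a} = ∑_σ χ^λ χ^μ χ^ν = a! · g(λ, μ, ν)`
   (`card_mul_finrank_invariants_sliceRep`, `kroneckerCoeff_eq_sum_spechtCharacter_holds`), so
   `g(λ, μ, ν)` is the dimension of the space of such `M` invariant under the diagonal action of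
   `S_a` on the positions (`finrank_invariants_tripleHwRep`).
2. **Multiplying** (§1–§3): the concatenation product `(M ⊙ M')(t) = M(t|_a) · M'(t|^b)` of such an
   `M` (for `a`, weights `λ, μ, ν`) and `M'` (for `b`, weights `λ', μ', ν'`) has its partial functions
   in `HW_{λ+λ'}`, `HW_{μ+μ'}`, `HW_{ν+ν'}` (`g ∈ GL_N` acts on a concatenation product factorwise,
   `wordRep_concatFun`), and so does its symmetrisation `∑_{τ ∈ S_{a+b}} τ · (M ⊙ M')`, which is
   moreover `S_{a+b}`-invariant.
3. **Nonvanishing** (§2): reading a function on words of length `n` in an alphabet `A` as the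
   polynomial `∑_w F(w) X^{w}` in `k[X_x : x ∈ A]` (`wordPoly`) turns concatenation into the product
   of polynomials and is injective on `S_n`-invariant functions (words with the same content are
   permutations of each other); since `k[X]` is a domain, the symmetrised product of two nonzero
   invariant functions is nonzero (`symFun_concatFun_ne_zero`). Hence `g(λ+λ', μ+μ', ν+ν') ≥ 1`.

## References

* M. Christandl, A. W. Harrow, G. Mitchison, Comm. Math. Phys. 270 (2007) 575–585 (the
  semigroup property of the Kronecker coefficients).
* C. Ikenmeyer, G. Panova, Adv. Math. 319 (2017) 40–66 = arXiv:1512.03798, §1.1 (the semigroup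
  property). [key `IkenmeyerPanova2017`]
* W. Fulton, J. Harris, GTM 129, Thm. 6.3 (2), §2.2 (2.9), Prop. 2.1. [key `FultonHarrisGTM129`]

## Mathlib and tree

Mathlib: `Fin.append`/`Fin.appendEquiv`/`Fin.prod_univ_add`, `Finset.sum_mul_sum`,
`MvPolynomial` (a domain over a field), `Equiv.Perm`, `Representation.invariants`,
`Representation.char_iso`/`char_tensor`. Tree: `wordRep`, `wordRep_apply`, `wordPerm`,
`highestWeightSpace`, `weightChar_add` (`TensorWordModel`); `hwPermRep`, `character_hwPermRep`
(`WordHighestWeightSpecht`); `highestWeightSpace_le_comap_wordPermRep`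
(`SchurWeylPlethysmKroneckerBoundProofs`); `sliceSubmodule`, `sliceRep`, `sliceRepEquiv`, `pairRep_apply_apply`,
`card_mul_finrank_invariants_sliceRep` (`SliceRepresentation`); `kroneckerCoeff`,
`spechtCharacter`, `kroneckerCoeff_eq_sum_spechtCharacter_holds`; `wordExp`,
`exists_comp_perm_eq_of_wordExp_eq`, `prod_X_eq_monomial_wordExp` (`Hyperdeterminant`).
-/

noncomputable section

open scoped BigOperators TensorProduct

namespace Literature.NumberTheory.DiophantineGeometry

/-! ### 1. The concatenation product and the symmetrisation of functions on words -/

section Concat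

variable {k : Type*} [CommRing k] {α : Type*} {a b n : ℕ}

/-- The **concatenation product** of a function on words of length `a` and one on words of length
`b` (alphabet `α`): `(F ⊙ G)(w) = F(w|_{[0,a)}) · G(w|_{[a,a+b)})` — the tensor product
`F ⊗ G ∈ (k^A)^{⊗a} ⊗ (k^A)^{⊗b} = (k^A)^{⊗(a+b)}` in coordinates. [folklore] -/
def concatFun (F : (Fin a → α) → k) (G : (Fin b → α) → k) : (Fin (a + b) → α) → k :=
  fun w => F (fun i => w (Fin.castAdd b i)) * G (fun j => w (Fin.natAdd a j))

/-- Unfolding lemma for `concatFun`. [folklore] -/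
theorem concatFun_apply (F : (Fin a → α) → k) (G : (Fin b → α) → k) (w : Fin (a + b) → α) :
    concatFun F G w = F (fun i => w (Fin.castAdd b i)) * G (fun j => w (Fin.natAdd a j)) :=
  rfl

/-- The concatenation product evaluated at a concatenated word. [folklore] -/
theorem concatFun_append (F : (Fin a → α) → k) (G : (Fin b → α) → k) (u : Fin a → α)
    (v : Fin b → α) : concatFun F G (Fin.append u v) = F u * G v := by
  rw [concatFun_apply]
  congr 2
  · funext i; exact Fin.append_left u v i
  · funext j; exact Fin.append_right u v j

/-- The **symmetrisation** `∑_{τ ∈ S_n} τ · H` of a function on words of length `n` under the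
position action (`(τ · H)(w) = H(w ∘ τ)`, `wordPerm`). [folklore] -/
def symFun (H : (Fin n → α) → k) : (Fin n → α) → k :=
  fun w => ∑ τ : Equiv.Perm (Fin n), H (w ∘ ⇑τ)

/-- Unfolding lemma for `symFun`. [folklore] -/
theorem symFun_apply (H : (Fin n → α) → k) (w : Fin n → α) :
    symFun H w = ∑ τ : Equiv.Perm (Fin n), H (w ∘ ⇑τ) :=
  rfl

/-- The symmetrisation is invariant under the position action. [folklore] -/
theorem symFun_comp_perm (H : (Fin n → α) → k) (σ : Equiv.Perm (Fin n)) (w : Fin n → α) :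
    symFun H (w ∘ ⇑σ) = symFun H w := by
  rw [symFun_apply, symFun_apply]
  exact Fintype.sum_equiv (Equiv.mulLeft σ) _ _ fun τ => rfl

end Concat

/-! ### 2. Functions on words as polynomials: products and nonvanishing -/

section Poly

open MvPolynomial Literature.Computability.AlgebraicComplexity

variable {k : Type*} [Field k] {α : Type*} [Fintype α] {a b n : ℕ}

/-- The polynomial `∑_w F(w) X^{w} ∈ k[X_x : x ∈ α]` of a function on words of length `n`
(`X^w = ∏_p X_{w p}`, the monomial of the content `wordExp w` of `w`): the image of the tensor
`F ∈ (k^A)^{⊗n}` in the symmetric algebra `Sym(k^A) = k[X]`. [folklore] -/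
def wordPoly (F : (Fin n → α) → k) : MvPolynomial α k :=
  ∑ w : Fin n → α, F w • monomial (wordExp w) (1 : k)

omit [Fintype α] in
/-- The content of a concatenated word is the sum of the contents. [folklore] -/
theorem wordExp_append (u : Fin a → α) (v : Fin b → α) :
    wordExp (Fin.append u v) = wordExp u + wordExp v := by
  unfold wordExp
  rw [Fin.sum_univ_add]
  simp only [Fin.append_left, Fin.append_right]

/-- **Concatenation becomes multiplication**: `P_{F ⊙ G} = P_F · P_G`. [folklore] -/
theorem wordPoly_concatFun (F : (Fin a → α) → k) (G : (Fin b → α) → k) :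
    wordPoly (concatFun F G) = wordPoly F * wordPoly G := by
  rw [wordPoly, wordPoly, wordPoly, Finset.sum_mul_sum, ← Finset.sum_product']
  rw [← Fintype.sum_equiv (Fin.appendEquiv a b) (fun x => F x.1 • monomial (wordExp x.1) (1 : k) *
      G x.2 • monomial (wordExp x.2) (1 : k)) _ (fun x => ?_)]
  · rfl
  · have hx : (Fin.appendEquiv a b) x = Fin.append x.1 x.2 := rfl
    rw [hx, concatFun_append, smul_mul_smul_comm, monomial_mul, mul_one, mul_smul, wordExp_append,
      smul_smul]

/-- The polynomial is invariant under the position action: `P_{τ · F} = P_F`. [folklore] -/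
theorem wordPoly_comp_perm (F : (Fin n → α) → k) (τ : Equiv.Perm (Fin n)) :
    wordPoly (fun w => F (w ∘ ⇑τ)) = wordPoly F := by
  rw [wordPoly, wordPoly]
  -- reindex `w ↦ w ∘ τ`
  let e : (Fin n → α) ≃ (Fin n → α) :=
    { toFun := fun w => w ∘ ⇑τ
      invFun := fun w => w ∘ ⇑τ⁻¹
      left_inv := fun w => by funext p; simp
      right_inv := fun w => by funext p; simp }
  refine Fintype.sum_equiv e _ _ fun w => ?_
  show F (w ∘ ⇑τ) • monomial (wordExp w) (1 : k) = F (w ∘ ⇑τ) • monomial (wordExp (w ∘ ⇑τ)) 1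
  rw [wordExp_comp_perm]

/-- The polynomial of a symmetrisation: `P_{∑_τ τ·H} = n! · P_H`. [folklore] -/
theorem wordPoly_symFun (H : (Fin n → α) → k) :
    wordPoly (symFun H) = (Nat.factorial n : k) • wordPoly H := by
  have h : wordPoly (symFun H) = ∑ τ : Equiv.Perm (Fin n), wordPoly (fun w => H (w ∘ ⇑τ)) := by
    rw [wordPoly]
    simp_rw [symFun_apply, Finset.sum_smul]
    rw [Finset.sum_comm]
    rfl
  rw [h]
  simp_rw [wordPoly_comp_perm]
  rw [Finset.sum_const, Finset.card_univ, Fintype.card_perm, Fintype.card_fin, ← Nat.cast_smul_eq_nsmul k]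

/-- The coefficient of `X^{w₀}` in `P_F` is the sum of `F` over the words with the content of
`w₀`. [folklore] -/
theorem coeff_wordPoly [DecidableEq α] (F : (Fin n → α) → k) (w₀ : Fin n → α) :
    coeff (wordExp w₀) (wordPoly F) =
      ∑ w ∈ Finset.univ.filter (fun w : Fin n → α => wordExp w = wordExp w₀), F w := by
  rw [wordPoly, coeff_sum, Finset.sum_filter]
  refine Finset.sum_congr rfl fun w _ => ?_
  rw [coeff_smul, coeff_monomial, smul_eq_mul]
  split_ifs with h
  · rw [mul_one]
  · rw [mul_zero]

/-- **Injectivity on invariant functions.** If `F` is invariant under the position action of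
`S_n` and `P_F = 0` then `F = 0`: the coefficient of `X^{w₀}` in `P_F` is
`#{w : content w = content w₀} · F(w₀)`, words of equal content being permutations of each other
(characteristic zero). [folklore] -/
theorem eq_zero_of_wordPoly_eq_zero [CharZero k] [DecidableEq α] {F : (Fin n → α) → k}
    (hF : ∀ (τ : Equiv.Perm (Fin n)) (w : Fin n → α), F (w ∘ ⇑τ) = F w)
    (h0 : wordPoly F = 0) : F = 0 := by
  funext w₀
  have hc := coeff_wordPoly F w₀
  rw [h0, coeff_zero] at hc
  have hconst : ∀ w ∈ Finset.univ.filter (fun w : Fin n → α => wordExp w = wordExp w₀),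
      F w = F w₀ := by
    intro w hw
    simp only [Finset.mem_filter, Finset.mem_univ, true_and] at hw
    obtain ⟨π, hπ⟩ := exists_comp_perm_eq_of_wordExp_eq hw.symm
    rw [← hπ, hF]
  rw [Finset.sum_congr rfl hconst, Finset.sum_const, nsmul_eq_mul] at hc
  have hcard : (Finset.univ.filter (fun w : Fin n → α => wordExp w = wordExp w₀)).card ≠ 0 :=
    Finset.card_ne_zero.mpr ⟨w₀, by simp⟩
  exact (mul_eq_zero.mp hc.symm).resolve_left (Nat.cast_ne_zero.mpr hcard)

/-- **The symmetrised concatenation product of two nonzero invariant functions is nonzero**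
(characteristic zero): `P_{∑ τ·(F ⊙ G)} = (a+b)! · P_F · P_G ≠ 0` in the domain `k[X]`.
[folklore] -/
theorem symFun_concatFun_ne_zero [CharZero k] [DecidableEq α] {F : (Fin a → α) → k}
    {G : (Fin b → α) → k}
    (hF : ∀ (τ : Equiv.Perm (Fin a)) (w : Fin a → α), F (w ∘ ⇑τ) = F w)
    (hG : ∀ (τ : Equiv.Perm (Fin b)) (w : Fin b → α), G (w ∘ ⇑τ) = G w)
    (hF0 : F ≠ 0) (hG0 : G ≠ 0) : symFun (concatFun F G) ≠ 0 := by
  intro h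
  have hP : wordPoly (symFun (concatFun F G)) = 0 := by rw [h, wordPoly]; simp
  rw [wordPoly_symFun, wordPoly_concatFun, smul_eq_zero] at hP
  rcases hP with hP | hP
  · exact Nat.cast_ne_zero.mpr (Nat.factorial_ne_zero _) hP
  · rcases mul_eq_zero.mp hP with hP | hP
    · exact hF0 (eq_zero_of_wordPoly_eq_zero hF hP)
    · exact hG0 (eq_zero_of_wordPoly_eq_zero hG hP)

end Poly

/-! ### 3. `GL_N` acts factorwise on concatenation products; highest weights add -/

section HW

variable {k : Type*} [Field k] {N a b : ℕ}

/-- **`g · (F ⊙ G) = (g · F) ⊙ (g · G)`** for `g ∈ GL_N(k)` acting diagonally on the tensor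
powers `(k^N)^{⊗(a+b)} = (k^N)^{⊗a} ⊗ (k^N)^{⊗b}` (in the word model, `wordRep_apply`: the sum over
words of length `a + b` of a product splits). Fulton–Harris §6.1. [folklore] -/
theorem wordRep_concatFun (g : GL (Fin N) k) (F : Word N a → k) (G : Word N b → k) :
    wordRep k N (a + b) g (concatFun F G) = concatFun (wordRep k N a g F) (wordRep k N b g G) := by
  funext w'
  rw [wordRep_apply, concatFun_apply, wordRep_apply, wordRep_apply, Finset.sum_mul_sum,
    ← Finset.sum_product']
  refine (Fintype.sum_equiv (Fin.appendEquiv a b) _ _ fun x => ?_).symm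
  have hx : (Fin.appendEquiv a b) x = Fin.append x.1 x.2 := rfl
  rw [hx, concatFun_append, Fin.prod_univ_add]
  simp only [Fin.append_left, Fin.append_right]
  ring

/-- **Highest-weight vectors multiply**: if `F ∈ HW_χ((k^N)^{⊗a})` and `G ∈ HW_ψ((k^N)^{⊗b})` then
`F ⊙ G ∈ HW_{χ+ψ}((k^N)^{⊗(a+b)})` (upper triangular Borel; `χ(b) ψ(b) = (χ+ψ)(b)`).
Christandl–Harrow–Mitchison 2007; Ikenmeyer–Panova §1.1 ("multiplying highest weight
vectors"). [cite: IkenmeyerPanova2017, §1.1 (the semigroup property)] -/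
theorem concatFun_mem_highestWeightSpace {χ ψ : Weight (Fin N)} {F : Word N a → k}
    {G : Word N b → k} (hF : F ∈ highestWeightSpace (wordRep k N a) χ)
    (hG : G ∈ highestWeightSpace (wordRep k N b) ψ) :
    concatFun F G ∈ highestWeightSpace (wordRep k N (a + b)) (χ + ψ) := by
  intro g hg
  rw [wordRep_concatFun, hF g hg, hG g hg, weightChar_add _ _ hg]
  funext w
  simp only [concatFun_apply, Pi.smul_apply, smul_eq_mul]
  ring

end HW

/-! ### 4. Triple tensors: the slice space `HW_λ ⊗ HW_μ ⊗ HW_ν` and its `S_n`-invariants -/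

section Triple

variable {k : Type*} [Field k] {N n a b : ℕ}

/-- Triples of words of length `n` (the index set of the basis of
`(k^N)^{⊗n} ⊗ (k^N)^{⊗n} ⊗ (k^N)^{⊗n}`). [folklore] -/
abbrev Word3 (N n : ℕ) : Type := (Word N n × Word N n) × Word N n

/-- The diagonal position action of `τ ∈ S_n` on a triple of words. [folklore] -/
def permute3 (τ : Equiv.Perm (Fin n)) (t : Word3 N n) : Word3 N n :=
  ((t.1.1 ∘ ⇑τ, t.1.2 ∘ ⇑τ), t.2 ∘ ⇑τ)

/-- `permute3` is a right action: `permute3 (σ τ) t = permute3 τ (permute3 σ t)`. [folklore] -/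
theorem permute3_mul (σ τ : Equiv.Perm (Fin n)) (t : Word3 N n) :
    permute3 (σ * τ) t = permute3 τ (permute3 σ t) :=
  rfl

/-- `permute3 1 = id`. [folklore] -/
theorem permute3_one (t : Word3 N n) : permute3 (1 : Equiv.Perm (Fin n)) t = t :=
  rfl

/-- A triple of words of length `n` read as one word of length `n` in the alphabet
`(Fin N × Fin N) × Fin N` (position `p ↦` the triple of letters at `p`). [folklore] -/
def zip3 : Word3 N n ≃ (Fin n → (Fin N × Fin N) × Fin N) where
  toFun t := fun p => ((t.1.1 p, t.1.2 p), t.2 p)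
  invFun w := ((fun p => (w p).1.1, fun p => (w p).1.2), fun p => (w p).2)
  left_inv _ := rfl
  right_inv _ := rfl

/-- The diagonal position action corresponds to the position action on zipped words. [folklore] -/
theorem zip3_symm_comp (w : Fin n → (Fin N × Fin N) × Fin N) (τ : Equiv.Perm (Fin n)) :
    (zip3 (N := N)).symm (w ∘ ⇑τ) = permute3 τ (zip3.symm w) :=
  rfl

/-- The first `a` letters of a triple of words of length `a + b`. [folklore] -/
def take3 (t : Word3 N (a + b)) : Word3 N a :=
  ((fun i => t.1.1 (Fin.castAdd b i), fun i => t.1.2 (Fin.castAdd b i)), fun i => t.2 (Fin.castAdd b i))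

/-- The last `b` letters of a triple of words of length `a + b`. [folklore] -/
def drop3 (t : Word3 N (a + b)) : Word3 N b :=
  ((fun j => t.1.1 (Fin.natAdd a j), fun j => t.1.2 (Fin.natAdd a j)), fun j => t.2 (Fin.natAdd a j))

/-- The **concatenation product of triple tensors**: `(M ⊙ M')(t) = M(t|_{[0,a)}) · M'(t|_{[a,a+b)})`.
[folklore] -/
def concat3 (M : Word3 N a → k) (M' : Word3 N b → k) : Word3 N (a + b) → k :=
  fun t => M (take3 t) * M' (drop3 t)

/-- The **symmetrisation** `∑_{τ ∈ S_n} τ · H` of a triple tensor under the diagonal position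
action. [folklore] -/
def sym3 (H : Word3 N n → k) : Word3 N n → k :=
  fun t => ∑ τ : Equiv.Perm (Fin n), H (permute3 τ t)

/-- The concatenation product of triple tensors is the concatenation product of the zipped
functions. [folklore] -/
theorem concat3_comp_zip3_symm (M : Word3 N a → k) (M' : Word3 N b → k) :
    concat3 M M' ∘ ⇑(zip3 (N := N) (n := a + b)).symm =
      concatFun (M ∘ ⇑(zip3 (N := N) (n := a)).symm) (M' ∘ ⇑(zip3 (N := N) (n := b)).symm) :=
  rfl

/-- The symmetrisation of a triple tensor is the symmetrisation of the zipped function.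
[folklore] -/
theorem sym3_comp_zip3_symm (H : Word3 N n → k) :
    sym3 H ∘ ⇑(zip3 (N := N) (n := n)).symm = symFun (H ∘ ⇑(zip3 (N := N) (n := n)).symm) :=
  rfl

/-- The symmetrisation is invariant under the diagonal position action. [folklore] -/
theorem sym3_permute3 (H : Word3 N n → k) (σ : Equiv.Perm (Fin n)) (t : Word3 N n) :
    sym3 H (permute3 σ t) = sym3 H t := by
  simp only [sym3, ← permute3_mul]
  exact Fintype.sum_equiv (Equiv.mulLeft σ) _ _ fun τ => rfl

/-- **The symmetrised concatenation product of two nonzero invariant triple tensors is nonzero**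
(characteristic zero; `symFun_concatFun_ne_zero` after zipping). [folklore] -/
theorem sym3_concat3_ne_zero [CharZero k] {M : Word3 N a → k} {M' : Word3 N b → k}
    (hM : ∀ τ t, M (permute3 τ t) = M t) (hM' : ∀ τ t, M' (permute3 τ t) = M' t)
    (hM0 : M ≠ 0) (hM0' : M' ≠ 0) : sym3 (concat3 M M') ≠ 0 := by
  classical
  intro h
  have h' : sym3 (concat3 M M') ∘ ⇑(zip3 (N := N) (n := a + b)).symm = 0 := by
    rw [h]; rfl
  rw [sym3_comp_zip3_symm, concat3_comp_zip3_symm] at h'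
  refine symFun_concatFun_ne_zero ?_ ?_ ?_ ?_ h'
  · intro τ w
    show M (zip3.symm (w ∘ ⇑τ)) = M (zip3.symm w)
    rw [zip3_symm_comp, hM]
  · intro τ w
    show M' (zip3.symm (w ∘ ⇑τ)) = M' (zip3.symm w)
    rw [zip3_symm_comp, hM']
  · intro h0
    apply hM0
    funext t
    have := congrFun h0 (zip3 t)
    simpa using this
  · intro h0
    apply hM0'
    funext t
    have := congrFun h0 (zip3 t)
    simpa using this

variable (k N n)

/-- **The triple slice space `HW_{χ₁} ⊗ HW_{χ₂} ⊗ HW_{χ₃}`** as functions on triples of words: all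
partial functions in the first word lie in `HW_{χ₁}((k^N)^{⊗n})`, in the second in `HW_{χ₂}`, in the
third in `HW_{χ₃}` (`sliceSubmodule` nested). Its `S_n`-invariants have dimension `g(λ, μ, ν)` for
`χᵢ` the weights of `λ, μ, ν` (`finrank_invariants_tripleHwRep`). Fulton–Harris §1.1, §6.1.
[folklore] -/
def tripleHw (χ₁ χ₂ χ₃ : Weight (Fin N)) : Submodule k (Word3 N n → k) :=
  sliceSubmodule (sliceSubmodule (highestWeightSpace (wordRep k N n) χ₁)
    (highestWeightSpace (wordRep k N n) χ₂)) (highestWeightSpace (wordRep k N n) χ₃)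

/-- The representation of `S_n` (diagonal position action) on the triple slice space
(`sliceRep` nested). [folklore] -/
def tripleHwRep (χ₁ χ₂ χ₃ : Weight (Fin N)) :
    Representation k (Equiv.Perm (Fin n)) (tripleHw k N n χ₁ χ₂ χ₃) :=
  sliceRep (sliceSubmodule_le_comap_pairRep (highestWeightSpace_le_comap_wordPermRep k (D := n) χ₁)
    (highestWeightSpace_le_comap_wordPermRep k (D := n) χ₂))
    (highestWeightSpace_le_comap_wordPermRep k (D := n) χ₃)

variable {k N n}

/-- Membership in the triple slice space (unfolding lemma). [folklore] -/
theorem mem_tripleHw_iff (χ₁ χ₂ χ₃ : Weight (Fin N)) (M : Word3 N n → k) :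
    M ∈ tripleHw k N n χ₁ χ₂ χ₃ ↔
      (∀ w₂ w₃, (fun w₁ => M ((w₁, w₂), w₃)) ∈ highestWeightSpace (wordRep k N n) χ₁) ∧
      (∀ w₁ w₃, (fun w₂ => M ((w₁, w₂), w₃)) ∈ highestWeightSpace (wordRep k N n) χ₂) ∧
      (∀ w₁ w₂, (fun w₃ => M ((w₁, w₂), w₃)) ∈ highestWeightSpace (wordRep k N n) χ₃) := by
  rw [tripleHw, mem_sliceSubmodule_iff]
  constructor
  · rintro ⟨h12, h3⟩
    refine ⟨fun w₂ w₃ => ((mem_sliceSubmodule_iff _).1 (h12 w₃)).1 w₂,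
      fun w₁ w₃ => ((mem_sliceSubmodule_iff _).1 (h12 w₃)).2 w₁, fun w₁ w₂ => h3 (w₁, w₂)⟩
  · rintro ⟨h1, h2, h3⟩
    exact ⟨fun w₃ => (mem_sliceSubmodule_iff _).2 ⟨fun w₂ => h1 w₂ w₃, fun w₁ => h2 w₁ w₃⟩,
      fun p => h3 p.1 p.2⟩

/-- A representation permuting the basis vectors acts on functions of two variables by the
inverse permutations of the arguments: if `ρ₁(g) e_q = e_{f₁ q}` and `ρ₂(g) e_q = e_{f₂ q}` then
`(g · M)(p) = M(f₁⁻¹ p₁, f₂⁻¹ p₂)` (`pairRep_apply_apply`). [folklore] -/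
theorem pairRep_apply_of_single {α β : Type*} [Fintype α] [Fintype β] [DecidableEq α]
    [DecidableEq β] {G : Type*} [Group G] {ρ₁ : Representation k G (α → k)}
    {ρ₂ : Representation k G (β → k)} {g : G} (f₁ : α ≃ α) (f₂ : β ≃ β)
    (h₁ : ∀ q, ρ₁ g (Pi.single q 1) = Pi.single (f₁ q) 1)
    (h₂ : ∀ q, ρ₂ g (Pi.single q 1) = Pi.single (f₂ q) 1) (M : α × β → k) (p : α × β) :
    pairRep ρ₁ ρ₂ g M p = M (f₁.symm p.1, f₂.symm p.2) := by
  rw [pairRep_apply_apply, Finset.sum_eq_single (f₁.symm p.1, f₂.symm p.2)]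
  · rw [h₁, h₂, Equiv.apply_symm_apply, Equiv.apply_symm_apply, Pi.single_eq_same,
      Pi.single_eq_same, mul_one, mul_one]
  · rintro ⟨q₁, q₂⟩ - hq
    rw [h₁, h₂]
    by_cases hq₁ : f₁ q₁ = p.1
    · have hq₂ : f₂ q₂ ≠ p.2 := by
        intro hq₂; apply hq
        rw [← hq₁, ← hq₂, Equiv.symm_apply_apply, Equiv.symm_apply_apply]
      rw [Pi.single_eq_of_ne (Ne.symm hq₂), mul_zero, mul_zero]
    · rw [Pi.single_eq_of_ne (Ne.symm hq₁), zero_mul, mul_zero]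
  · intro h; exact absurd (Finset.mem_univ _) h

/-- The position action permutes the basis: `τ · e_u = e_{u ∘ τ⁻¹}`, as an `Equiv` of words.
[folklore] -/
theorem wordPermRep_single (τ : Equiv.Perm (Fin n)) (u : Word N n) :
    wordPermRep k N n τ (Pi.single u 1) =
      Pi.single ((Equiv.arrowCongr τ (Equiv.refl (Fin N))) u) 1 := by
  rw [wordPermRep_apply, wordPerm_single]
  congr 1

/-- A representation permuting the basis vectors of both factors permutes the basis of the
functions of two variables: `g · e_{(q₁,q₂)} = e_{(f₁ q₁, f₂ q₂)}`. [folklore] -/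
theorem pairRep_single_of_single {α β : Type*} [Fintype α] [Fintype β] [DecidableEq α]
    [DecidableEq β] {G : Type*} [Group G] {ρ₁ : Representation k G (α → k)}
    {ρ₂ : Representation k G (β → k)} {g : G} (f₁ : α ≃ α) (f₂ : β ≃ β)
    (h₁ : ∀ q, ρ₁ g (Pi.single q 1) = Pi.single (f₁ q) 1)
    (h₂ : ∀ q, ρ₂ g (Pi.single q 1) = Pi.single (f₂ q) 1) (q : α × β) :
    pairRep ρ₁ ρ₂ g (Pi.single q 1) = Pi.single (Equiv.prodCongr f₁ f₂ q) 1 := by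
  funext p
  rw [pairRep_apply_of_single f₁ f₂ h₁ h₂, Pi.single_apply, Pi.single_apply]
  by_cases h : p = Equiv.prodCongr f₁ f₂ q
  · rw [if_pos h, if_pos]
    rw [h, Equiv.prodCongr_apply, Prod.map_fst, Prod.map_snd, Equiv.symm_apply_apply,
      Equiv.symm_apply_apply]
  · rw [if_neg h, if_neg]
    intro h'
    apply h
    rw [← h', Equiv.prodCongr_apply, Prod.map_apply, Equiv.apply_symm_apply,
      Equiv.apply_symm_apply]

/-- **The diagonal position action on triple tensors**: the representation `tripleHwRep` acts on
underlying functions by `(τ · M)(t) = M(permute3 τ t)`. [folklore] -/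
theorem coe_tripleHwRep_apply (χ₁ χ₂ χ₃ : Weight (Fin N)) (τ : Equiv.Perm (Fin n))
    (M : tripleHw k N n χ₁ χ₂ χ₃) (t : Word3 N n) :
    ((tripleHwRep k N n χ₁ χ₂ χ₃ τ M : tripleHw k N n χ₁ χ₂ χ₃) : Word3 N n → k) t =
      (M : Word3 N n → k) (permute3 τ t) := by
  classical
  have h : ((tripleHwRep k N n χ₁ χ₂ χ₃ τ M : tripleHw k N n χ₁ χ₂ χ₃) : Word3 N n → k) =
      pairRep (pairRep (wordPermRep k N n) (wordPermRep k N n)) (wordPermRep k N n) τ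
        (M : Word3 N n → k) := rfl
  rw [h, pairRep_apply_of_single
      (Equiv.prodCongr (Equiv.arrowCongr τ (Equiv.refl (Fin N)))
        (Equiv.arrowCongr τ (Equiv.refl (Fin N))))
      (Equiv.arrowCongr τ (Equiv.refl (Fin N)))
      (pairRep_single_of_single _ _ (wordPermRep_single τ) (wordPermRep_single τ))
      (wordPermRep_single τ)]
  rfl

/-- **`n! · dim (HW_λ ⊗ HW_μ ⊗ HW_ν)^{S_n} = ∑_σ χ^λ(σ) χ^μ(σ) χ^ν(σ)`** for partitions with at most
`N` parts (characteristic zero): the invariant-dimension formula for the nested slice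
representation (`card_mul_finrank_invariants_sliceRep` twice, `χ_{Y ⊗ X} = χ_Y χ_X`) and
Schur–Weyl duality `χ_{HW_μ} = χ^μ` (`character_hwPermRep`). Fulton–Harris (2.9), Prop. 2.1,
Thm. 6.3 (2). [cite: FultonHarrisGTM129, §2.2 (2.9) with Prop. 2.1 and Thm. 6.3 (2)] -/
theorem card_mul_finrank_invariants_tripleHwRep [CharZero k] (lam mu nu : Nat.Partition n)
    (hl : lam.parts.card ≤ N) (hm : mu.parts.card ≤ N) (hn : nu.parts.card ≤ N) :
    (Nat.factorial n : k) *
        (Module.finrank k (tripleHwRep k N n (Weight.ofPartition N lam) (Weight.ofPartition N mu)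
          (Weight.ofPartition N nu)).invariants : k) =
      ∑ g : Equiv.Perm (Fin n),
        spechtCharacter k lam g * spechtCharacter k mu g * spechtCharacter k nu g := by
  have hcard : Nat.card (Equiv.Perm (Fin n)) = n.factorial := by
    rw [Nat.card_eq_fintype_card, Fintype.card_perm, Fintype.card_fin]
  haveI : Invertible (Nat.card (Equiv.Perm (Fin n)) : k) :=
    invertibleOfNonzero (by rw [hcard]; exact_mod_cast n.factorial_ne_zero)
  have hYle := highestWeightSpace_le_comap_wordPermRep k (D := n) (Weight.ofPartition N lam)
  have hXle := highestWeightSpace_le_comap_wordPermRep k (D := n) (Weight.ofPartition N mu)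
  have hZle := highestWeightSpace_le_comap_wordPermRep k (D := n) (Weight.ofPartition N nu)
  have h := card_mul_finrank_invariants_sliceRep (sliceSubmodule_le_comap_pairRep hYle hXle) hZle
  rw [hcard] at h
  change (Nat.factorial n : k) * (Module.finrank k (tripleHwRep k N n (Weight.ofPartition N lam)
    (Weight.ofPartition N mu) (Weight.ofPartition N nu)).invariants : k) = _ at h
  rw [h]
  refine Finset.sum_congr rfl fun g _ => ?_
  -- the character of `HW_λ ⊗ HW_μ` on the inner slice space
  have h12 := Representation.char_iso
    (V := ↥(highestWeightSpace (wordRep k N n) (Weight.ofPartition N lam)) ⊗[k]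
      ↥(highestWeightSpace (wordRep k N n) (Weight.ofPartition N mu)))
    (sliceRepEquiv hYle hXle)
  rw [Representation.char_tensor] at h12
  have h12g := congrFun h12 g
  rw [Pi.mul_apply] at h12g
  -- Schur–Weyl: `χ_{HW_μ} = χ^μ`
  have hY : ((wordPermRep k N n).subrepresentation
      (highestWeightSpace (wordRep k N n) (Weight.ofPartition N lam)) hYle).character =
      spechtCharacter k lam := character_hwPermRep k lam hl
  have hX : ((wordPermRep k N n).subrepresentation
      (highestWeightSpace (wordRep k N n) (Weight.ofPartition N mu)) hXle).character =
      spechtCharacter k mu := character_hwPermRep k mu hm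
  have hZ : ((wordPermRep k N n).subrepresentation
      (highestWeightSpace (wordRep k N n) (Weight.ofPartition N nu)) hZle).character =
      spechtCharacter k nu := character_hwPermRep k nu hn
  rw [hY, hX] at h12g
  have h1 : ((pairRep (wordPermRep k N n) (wordPermRep k N n)).subrepresentation
        (sliceSubmodule (highestWeightSpace (wordRep k N n) (Weight.ofPartition N lam))
          (highestWeightSpace (wordRep k N n) (Weight.ofPartition N mu)))
        (sliceSubmodule_le_comap_pairRep hYle hXle)).character g =
      spechtCharacter k lam g * spechtCharacter k mu g := h12g.symm
  rw [h1, hZ]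

/-- **`dim (HW_λ ⊗ HW_μ ⊗ HW_ν)^{S_n} = g(λ, μ, ν)`** (partitions with at most `N` parts,
characteristic zero): combine `card_mul_finrank_invariants_tripleHwRep` with the character formula
`n! · g(λ, μ, ν) = ∑_σ χ^λ χ^μ χ^ν` (`kroneckerCoeff_eq_sum_spechtCharacter_holds`). This is the
highest-weight-vector description of the Kronecker coefficients (Christandl–Harrow–Mitchison 2007;
Ikenmeyer–Panova 2017, §1.1). [cite: IkenmeyerPanova2017, §1.1 (the semigroup property)] -/
theorem finrank_invariants_tripleHwRep [CharZero k] (lam mu nu : Nat.Partition n)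
    (hl : lam.parts.card ≤ N) (hm : mu.parts.card ≤ N) (hn : nu.parts.card ≤ N) :
    Module.finrank k (tripleHwRep k N n (Weight.ofPartition N lam) (Weight.ofPartition N mu)
        (Weight.ofPartition N nu)).invariants = kroneckerCoeff k lam mu nu := by
  have h1 := card_mul_finrank_invariants_tripleHwRep (k := k) lam mu nu hl hm hn
  have h2 := kroneckerCoeff_eq_sum_spechtCharacter_holds k lam mu nu
  rw [← h2, Nat.cast_mul] at h1
  have h3 := mul_left_cancel₀ (Nat.cast_ne_zero.mpr (Nat.factorial_ne_zero n)) h1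
  exact_mod_cast h3

/-! ### 5. Multiplying invariant triple tensors; the semigroup property -/

/-- **Concatenation products of triple tensors multiply the weights**: if all partial functions
of `M` lie in `HW_{χ₁}, HW_{χ₂}, HW_{χ₃}` (length `a`) and those of `M'` in `HW_{ψ₁}, HW_{ψ₂}, HW_{ψ₃}`
(length `b`), then those of `M ⊙ M'` lie in `HW_{χ₁+ψ₁}, HW_{χ₂+ψ₂}, HW_{χ₃+ψ₃}` (length `a + b`):
each partial function of `M ⊙ M'` is a concatenation product of partial functions
(`concatFun_mem_highestWeightSpace`); Christandl–Harrow–Mitchison 2007, Ikenmeyer–Panova §1.1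
("multiplying highest weight vectors"). [cite: IkenmeyerPanova2017, §1.1 (the semigroup property)] -/
theorem concat3_mem_tripleHw {χ₁ χ₂ χ₃ ψ₁ ψ₂ ψ₃ : Weight (Fin N)} {M : Word3 N a → k}
    {M' : Word3 N b → k} (hM : M ∈ tripleHw k N a χ₁ χ₂ χ₃) (hM' : M' ∈ tripleHw k N b ψ₁ ψ₂ ψ₃) :
    concat3 M M' ∈ tripleHw k N (a + b) (χ₁ + ψ₁) (χ₂ + ψ₂) (χ₃ + ψ₃) := by
  rw [mem_tripleHw_iff] at hM hM' ⊢
  obtain ⟨h1, h2, h3⟩ := hM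
  obtain ⟨h1', h2', h3'⟩ := hM'
  refine ⟨fun w₂ w₃ => ?_, fun w₁ w₃ => ?_, fun w₁ w₂ => ?_⟩
  · have : (fun w₁ => concat3 M M' ((w₁, w₂), w₃)) =
        concatFun (fun u => M ((u, fun i => w₂ (Fin.castAdd b i)), fun i => w₃ (Fin.castAdd b i)))
          (fun v => M' ((v, fun j => w₂ (Fin.natAdd a j)), fun j => w₃ (Fin.natAdd a j))) := rfl
    rw [this]
    exact concatFun_mem_highestWeightSpace (h1 _ _) (h1' _ _)
  · have : (fun w₂ => concat3 M M' ((w₁, w₂), w₃)) =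
        concatFun (fun u => M ((fun i => w₁ (Fin.castAdd b i), u), fun i => w₃ (Fin.castAdd b i)))
          (fun v => M' ((fun j => w₁ (Fin.natAdd a j), v), fun j => w₃ (Fin.natAdd a j))) := rfl
    rw [this]
    exact concatFun_mem_highestWeightSpace (h2 _ _) (h2' _ _)
  · have : (fun w₃ => concat3 M M' ((w₁, w₂), w₃)) =
        concatFun (fun u => M ((fun i => w₁ (Fin.castAdd b i), fun i => w₂ (Fin.castAdd b i)), u))
          (fun v => M' ((fun j => w₁ (Fin.natAdd a j), fun j => w₂ (Fin.natAdd a j)), v)) := rfl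
    rw [this]
    exact concatFun_mem_highestWeightSpace (h3 _ _) (h3' _ _)

/-- The triple slice space is stable under the diagonal position action (each partial function of
`τ · M` is `τ ·` a partial function of `M`, and highest-weight spaces are stable under the position
action). [folklore] -/
theorem permute3_mem_tripleHw {χ₁ χ₂ χ₃ : Weight (Fin N)} {M : Word3 N n → k}
    (hM : M ∈ tripleHw k N n χ₁ χ₂ χ₃) (τ : Equiv.Perm (Fin n)) :
    (fun t => M (permute3 τ t)) ∈ tripleHw k N n χ₁ χ₂ χ₃ := by
  rw [mem_tripleHw_iff] at hM ⊢
  obtain ⟨h1, h2, h3⟩ := hM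
  refine ⟨fun w₂ w₃ => ?_, fun w₁ w₃ => ?_, fun w₁ w₂ => ?_⟩
  · have : (fun w₁ => M (permute3 τ ((w₁, w₂), w₃))) =
        wordPerm k τ (fun u => M ((u, w₂ ∘ ⇑τ), w₃ ∘ ⇑τ)) := rfl
    rw [this]
    exact wordPerm_mem_highestWeightSpace τ (h1 _ _)
  · have : (fun w₂ => M (permute3 τ ((w₁, w₂), w₃))) =
        wordPerm k τ (fun u => M ((w₁ ∘ ⇑τ, u), w₃ ∘ ⇑τ)) := rfl
    rw [this]
    exact wordPerm_mem_highestWeightSpace τ (h2 _ _)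
  · have : (fun w₃ => M (permute3 τ ((w₁, w₂), w₃))) =
        wordPerm k τ (fun u => M ((w₁ ∘ ⇑τ, w₂ ∘ ⇑τ), u)) := rfl
    rw [this]
    exact wordPerm_mem_highestWeightSpace τ (h3 _ _)

/-- The symmetrisation of a triple tensor of the slice space lies in the slice space. [folklore] -/
theorem sym3_mem_tripleHw {χ₁ χ₂ χ₃ : Weight (Fin N)} {H : Word3 N n → k}
    (hH : H ∈ tripleHw k N n χ₁ χ₂ χ₃) : sym3 H ∈ tripleHw k N n χ₁ χ₂ χ₃ := by
  have : sym3 H = ∑ τ : Equiv.Perm (Fin n), fun t => H (permute3 τ t) := by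
    funext t
    rw [sym3, Finset.sum_apply]
  rw [this]
  exact Submodule.sum_mem _ fun τ _ => permute3_mem_tripleHw hH τ

/-- **A positive Kronecker coefficient gives a nonzero invariant triple tensor**: if
`g(λ, μ, ν) > 0` (partitions of `n` with at most `N` parts) there is a nonzero `S_n`-invariant
`M ∈ HW_λ ⊗ HW_μ ⊗ HW_ν` (`finrank_invariants_tripleHwRep`). [cite: IkenmeyerPanova2017, §1.1 (the semigroup property)] -/
theorem exists_invariant_of_kroneckerCoeff_pos [CharZero k] {lam mu nu : Nat.Partition n}
    (hl : lam.parts.card ≤ N) (hm : mu.parts.card ≤ N) (hn : nu.parts.card ≤ N)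
    (h : 0 < kroneckerCoeff k lam mu nu) :
    ∃ M : Word3 N n → k, M ∈ tripleHw k N n (Weight.ofPartition N lam) (Weight.ofPartition N mu)
        (Weight.ofPartition N nu) ∧ M ≠ 0 ∧ ∀ τ t, M (permute3 τ t) = M t := by
  rw [← finrank_invariants_tripleHwRep (k := k) lam mu nu hl hm hn] at h
  obtain ⟨x, hx⟩ := (Module.finrank_pos_iff_exists_ne_zero (R := k)
    (M := ↥(tripleHwRep k N n (Weight.ofPartition N lam) (Weight.ofPartition N mu)
      (Weight.ofPartition N nu)).invariants)).mp h
  refine ⟨((x : tripleHw k N n (Weight.ofPartition N lam) (Weight.ofPartition N mu)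
      (Weight.ofPartition N nu)) : Word3 N n → k), x.1.2, ?_, ?_⟩
  · intro h0
    apply hx
    apply Subtype.ext
    apply Subtype.ext
    exact h0
  · intro τ t
    have hinv := (Representation.mem_invariants _ _).1 x.2 τ
    have := congrArg (fun y : tripleHw k N n (Weight.ofPartition N lam) (Weight.ofPartition N mu)
      (Weight.ofPartition N nu) => (y : Word3 N n → k) t) hinv
    rwa [coe_tripleHwRep_apply] at this

/-- **A nonzero invariant triple tensor gives a positive Kronecker coefficient**: if some nonzero
`S_n`-invariant `M` lies in `HW_λ ⊗ HW_μ ⊗ HW_ν` (partitions of `n` with at most `N` parts) then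
`g(λ, μ, ν) > 0`. [cite: IkenmeyerPanova2017, §1.1 (the semigroup property)] -/
theorem kroneckerCoeff_pos_of_invariant [CharZero k] {lam mu nu : Nat.Partition n}
    (hl : lam.parts.card ≤ N) (hm : mu.parts.card ≤ N) (hn : nu.parts.card ≤ N)
    {M : Word3 N n → k} (hM : M ∈ tripleHw k N n (Weight.ofPartition N lam)
      (Weight.ofPartition N mu) (Weight.ofPartition N nu)) (hM0 : M ≠ 0)
    (hinv : ∀ τ t, M (permute3 τ t) = M t) : 0 < kroneckerCoeff k lam mu nu := by
  rw [← finrank_invariants_tripleHwRep (k := k) lam mu nu hl hm hn]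
  apply (Module.finrank_pos_iff_exists_ne_zero (R := k)
    (M := ↥(tripleHwRep k N n (Weight.ofPartition N lam) (Weight.ofPartition N mu)
      (Weight.ofPartition N nu)).invariants)).mpr
  let v : tripleHw k N n (Weight.ofPartition N lam) (Weight.ofPartition N mu)
    (Weight.ofPartition N nu) := ⟨M, hM⟩
  have hv : v ∈ (tripleHwRep k N n (Weight.ofPartition N lam) (Weight.ofPartition N mu)
      (Weight.ofPartition N nu)).invariants := by
    rw [Representation.mem_invariants]
    intro τ
    apply Subtype.ext
    funext t
    rw [coe_tripleHwRep_apply]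
    exact hinv τ t
  refine ⟨⟨v, hv⟩, fun h0 => hM0 ?_⟩
  have := congrArg (fun y => ((y.1 : tripleHw k N n (Weight.ofPartition N lam)
    (Weight.ofPartition N mu) (Weight.ofPartition N nu)) : Word3 N n → k)) h0
  exact this

/-- **The semigroup property of the Kronecker coefficients** (Christandl–Harrow–Mitchison 2007;
the first of the three properties of Ikenmeyer–Panova 2017, §1.1: "If … `g(λ, μ, ν) > 0`
and `g(λ', μ', ν') > 0`, then also `g(λ+λ', μ+μ', ν+ν') > 0`"). Here `λ, μ, ν ⊢ a`,
`λ', μ', ν' ⊢ b`, and the row-wise sums `Λ, Μ, Ν ⊢ a + b` are specified by their weights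
`ofPartition N Λ = ofPartition N λ + ofPartition N λ'` etc., for any `N` bounding the number of
parts of all nine partitions; over any field of characteristic zero. Proof: nonzero invariant
triple tensors `M ∈ HW_λ ⊗ HW_μ ⊗ HW_ν`, `M' ∈ HW_{λ'} ⊗ HW_{μ'} ⊗ HW_{ν'}`
(`exists_invariant_of_kroneckerCoeff_pos`) have the nonzero invariant symmetrised product
`∑_τ τ · (M ⊙ M') ∈ HW_Λ ⊗ HW_Μ ⊗ HW_Ν` (`concat3_mem_tripleHw`, `sym3_mem_tripleHw`,
`sym3_concat3_ne_zero`), whence `g(Λ, Μ, Ν) > 0` (`kroneckerCoeff_pos_of_invariant`).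
[cite: IkenmeyerPanova2017, §1.1 (the semigroup property)] -/
theorem kroneckerCoeff_pos_of_ofPartition_add [CharZero k] {a b : ℕ} (N : ℕ)
    {lam mu nu : Nat.Partition a} {lam' mu' nu' : Nat.Partition b}
    {Lam Mu Nu : Nat.Partition (a + b)}
    (hl : lam.parts.card ≤ N) (hm : mu.parts.card ≤ N) (hn : nu.parts.card ≤ N)
    (hl' : lam'.parts.card ≤ N) (hm' : mu'.parts.card ≤ N) (hn' : nu'.parts.card ≤ N)
    (hL : Lam.parts.card ≤ N) (hM : Mu.parts.card ≤ N) (hN : Nu.parts.card ≤ N)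
    (eL : Weight.ofPartition N Lam = Weight.ofPartition N lam + Weight.ofPartition N lam')
    (eM : Weight.ofPartition N Mu = Weight.ofPartition N mu + Weight.ofPartition N mu')
    (eN : Weight.ofPartition N Nu = Weight.ofPartition N nu + Weight.ofPartition N nu')
    (h : 0 < kroneckerCoeff k lam mu nu) (h' : 0 < kroneckerCoeff k lam' mu' nu') :
    0 < kroneckerCoeff k Lam Mu Nu := by
  obtain ⟨M, hMmem, hM0, hMinv⟩ := exists_invariant_of_kroneckerCoeff_pos (k := k) hl hm hn h
  obtain ⟨M', hMmem', hM0', hMinv'⟩ :=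
    exists_invariant_of_kroneckerCoeff_pos (k := k) hl' hm' hn' h'
  refine kroneckerCoeff_pos_of_invariant hL hM hN (M := sym3 (concat3 M M')) ?_
    (sym3_concat3_ne_zero hMinv hMinv' hM0 hM0') (fun τ t => sym3_permute3 _ τ t)
  rw [eL, eM, eN]
  exact sym3_mem_tripleHw (concat3_mem_tripleHw hMmem hMmem')

end Triple

end Literature.NumberTheory.DiophantineGeometry
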